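import Summits.ResolutionOfSingularities.ResolutionOfSingularities.Theorems.HilbertSamuelEliminationSigmaMaxModificationsCorridor3WLadderStrataStrictTransform
import Summits.ResolutionOfSingularities.ResolutionOfSingularities.Theorems.HilbertSamuelEliminationSigmaMaxModificationsCorridor3SigmaStrataDepthE
import Summits.ResolutionOfSingularities.ResolutionOfSingularities.Theorems.HilbertSamuelEliminationSigmaMaxModificationsCorridor3SigmaStrataParts
import Summits.ResolutionOfSingularities.ResolutionOfSingularities.Theorems.HilbertSamuelEliminationSigmaMaxModificationsCorridor3SigmaHybridScope
import HarnessLib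

/-!
# [OURS · L1 W4.2] `Corridor3WLadderHybridLowStrict` — the LABEL-CLEAN CALCULUS of ONE σE-STEP for an ARBITRARY boundary-reading strategy:
# labels along σE-steps («dominates ⇒ inherits; otherwise the new year»), kernel (K-str) PROVED strategy-free (a dominating component off the
# centre is the strict transform; the strict transform of a curve regular at `x_n` is a regular curve at `x_{n+1}`), and the one-step lemmas
# persist / birth / reset with (K-ctr) as the only hypothesis at the step

Crux chain w42 (`SigmaMaxModifications`, stmt-ResolutionOfSingularities-18506; conjunct `SigmaMaxModificationsCorridor3`,
stmt-ResolutionOfSingularities-19249), res-L1-w42-plan-1 RULINGS v3.14-21 (FS), v3.14-22 (FW), v3.14-35 (HR). Typer res-type-040 (gen 19). PROOF FILE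
(no definitions). OURS (cell res-hironaka, slot W4.2); NOT statements of H. Hironaka's manuscript [Hironaka2017] nor of [CossartJannsenSaito2020];
AI-typed, weaker than expert review. Helper file `--supports stmt-ResolutionOfSingularities-19249 --as helper` (counted 0).

WHAT. Stub-4's label-clean calculus (`…WLadderStrataClean`, `…WLadderStrataStrictDominant`, `…WLadderStrataStrictTransform`: `LabelCleanAt`,
`IsRegularCurveAt`, `StepProjection.exists_parent / eq_strictTransformSet_of_closure_image_eq / dominant_unique / isRegularCurveAt_of_dominant`,
`LabelCleanAt.persist`, `labelCleanAt_birth`, `labelCleanAt_reset`) is typed for the CJS chains `CanonicalNearStep R`. The (c-reg) supplier of the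
strategy-generic Low adapter (`…WLadderHybridLowRegular`) runs it along σE-chains of an arbitrary `σ : StrategyE` (the menu hybrid
`π.hybrid (ofStageOracleE ω)` in particular), on RunGood stages (`RunGood k N ν`, p532236: finite type over a field, reduced, `dim ≤ N`, `ν` never
exceeded). This file is the E-copy; the geometric cores are stub-4's and are CITED, not restated (`Moving.eq_strictTransformSet_blowup`, p519120;
`Moving.isRegular_and_dim_le_one_strictTransform_blowup`, p519642).

* §1 labels along σE-steps, any `σ`: `CanonicalNearStepσE.year_eq / label_cases / label_le_year`, `StepProjectionσE.label_eq_of_mem /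
  mem_componentsIn_of_label_ne / closure_image_mem_componentsThrough / exists_parent`, `label_le_year_of_reachesσE`.
* §2 (K-str) for σE-steps, any FUNCTIONAL `σ` on RunGood stages: `StepProjectionσE.eq_strictTransformSet_of_closure_image_eq`,
  `StepProjectionσE.dominant_unique`, `StepProjectionσE.isRegularCurveAt_of_dominant`.
* §3 one step of the calculus along a σE-step: `LabelCleanAt.persist_σE` ((K-ctr) at the step as hypothesis, (K-str) discharged),
  `labelCleanAt_birth_σE` (newborn components lie over a PERMISSIBLE centre, `Sigma.subset_preimage_support_of_not_mem_componentsIn`),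
  `labelCleanAt_reset_of_support_eq` (after a step whose centre IS the part `Y_n^{(j)}` the label `j` is clean — the END step of a fallback cycle).

References: CJS LNM 2270 Rem. 6.29 (1) pp. 91–92, p. 102, Lemma 3.15 (1) [CossartJannsenSaito2020]; Görtz–Wedhorn I Prop. 13.91, 13.96 (2), (13.19)
[GortzWedhorn2020]; tree files above and `…SigmaStrataDepthE` (`StepProjectionσE.isClosed_pt`), `…SigmaHybridScope` (`RunGood`).
-/

noncomputable section

set_option linter.dupNamespace false

open CategoryTheory AlgebraicGeometry TopologicalSpace Topology IsLocalRing
open Summit.ResolutionOfSingularities.ResolutionOfSingularities.Theorems.CampaignW42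
open Literature.AlgebraicGeometry.Resolution Literature.RingTheory.HilbertSamuel
open Literature.AlgebraicGeometry.CossartJannsenSaito2020
open Summit.ResolutionOfSingularities.ResolutionOfSingularities.Theorems.SigmaMaxModificationsCorridor3
open Summit.ResolutionOfSingularities.ResolutionOfSingularities.Theorems.SigmaMaxModificationsCorridor3.Moving

namespace Summit.ResolutionOfSingularities.ResolutionOfSingularities.Theorems.SigmaMaxModificationsCorridor3.Sigma

universe u

variable {σ : StrategyE.{u}} {N : ℕ} {ν : ℕ → ℕ} {s s' : MarkedStageE.{u}}

/-! ## §1. Labels along σE-steps («dominates ⇒ inherits; otherwise the new year» is strategy-independent) -/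

/-- Along a σE-step the year goes up by one. [cite: CossartJannsenSaito2020, Rem. 6.29 (1)] -/
theorem CanonicalNearStepσE.year_eq (h : CanonicalNearStepσE σ N ν s s') : s'.L.year = s.L.year + 1 := by
  obtain ⟨C, P', hln, x', -, -, -, -, rfl⟩ := h
  rfl

/-- **«Dominates ⇒ inherits; otherwise the new label»** along a σE-step. [cite: CossartJannsenSaito2020, Rem. 6.29 (1)] -/
theorem CanonicalNearStepσE.label_cases (h : CanonicalNearStepσE σ N ν s s') (Z' : Set s'.W) :
    s'.L.label Z' = s.L.year + 1 ∨ ∃ Z ∈ componentsIn (Scheme.hsStratum s.W N ν), s'.L.label Z' = s.L.label Z := by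
  obtain ⟨C, P', hln, x', -, -, -, -, rfl⟩ := h
  by_cases hZ : closure (blowup.π C '' Z') ∈ componentsIn (Scheme.hsStratum s.W N ν)
  · exact Or.inr ⟨_, hZ, s.L.next_label_of_mem C hZ⟩
  · exact Or.inl (s.L.next_label_of_not_mem C hZ)

/-- **Labels stay `≤` year along σE-steps.** [cite: CossartJannsenSaito2020, Rem. 6.29 (1)] -/
theorem CanonicalNearStepσE.label_le_year (h : CanonicalNearStepσE σ N ν s s') (hlab : ∀ Z, s.L.label Z ≤ s.L.year) (Z' : Set s'.W) :
    s'.L.label Z' ≤ s'.L.year := by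
  rw [h.year_eq]
  rcases h.label_cases Z' with hnew | ⟨Z, -, hold⟩
  · rw [hnew]
  · rw [hold]
    exact (hlab Z).trans (Nat.le_succ _)

/-- Labels `≤` year is inherited along `ReachesσE`. [cite: CossartJannsenSaito2020, Rem. 6.29 (1)] -/
theorem label_le_year_of_reachesσE {s₀ s : MarkedStageE.{u}} (hr : ReachesσE σ N ν s₀ s) (hlab : ∀ Z, s₀.L.label Z ≤ s₀.L.year)
    (Z : Set s.W) : s.L.label Z ≤ s.L.year := by
  induction hr with
  | refl => exact hlab Z
  | tail _ hlast ih => exact hlast.label_le_year ih Z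

namespace StepProjectionσE

variable {f : s'.W ⟶ s.W}

/-- The year goes up by one. [folklore] -/
theorem year_eq (hf : StepProjectionσE σ N ν s s' f) : s'.L.year = s.L.year + 1 :=
  hf.canonicalNearStepσE.year_eq

/-- **«Dominates ⇒ inherits»** read through a σE-step projection. [cite: CossartJannsenSaito2020, Rem. 6.29 (1)] -/
theorem label_eq_of_mem (hf : StepProjectionσE σ N ν s s' f) {Z' : Set s'.W}
    (hZ : closure (f.base '' Z') ∈ componentsIn (Scheme.hsStratum s.W N ν)) :
    s'.L.label Z' = s.L.label (closure (f.base '' Z')) := by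
  obtain ⟨C, P', hln, x', -, -, -, -, e, rfl⟩ := hf
  subst e
  simp only [eqToHom_refl, Category.id_comp] at hZ ⊢
  exact s.L.next_label_of_mem C hZ

/-- **«Otherwise it gets the new year»**, contrapositive, through a σE-step projection. [cite: CossartJannsenSaito2020, Rem. 6.29 (1)] -/
theorem mem_componentsIn_of_label_ne (hf : StepProjectionσE σ N ν s s' f) {Z' : Set s'.W} (hne : s'.L.label Z' ≠ s.L.year + 1) :
    closure (f.base '' Z') ∈ componentsIn (Scheme.hsStratum s.W N ν) := by
  obtain ⟨C, P', hln, x', -, -, -, -, e, rfl⟩ := hf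
  subst e
  simp only [eqToHom_refl, Category.id_comp]
  by_contra hZ
  exact hne (s.L.next_label_of_not_mem C hZ)

/-- **Domination continues a lineage through the chain points** (σE-copy). [cite: CossartJannsenSaito2020, Rem. 6.29 (1)] -/
theorem closure_image_mem_componentsThrough (hf : StepProjectionσE σ N ν s s' f) {Z' : Set s'.W}
    (hZ' : Z' ∈ componentsThrough N ν s'.toMarkedStage) (hdom : closure (f.base '' Z') ∈ componentsIn (Scheme.hsStratum s.W N ν)) :
    closure (f.base '' Z') ∈ componentsThrough N ν s.toMarkedStage :=
  ⟨hdom, subset_closure ⟨s'.pt, hZ'.2, hf.base_pt⟩⟩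

/-- **An OLD label is inherited from a parent through the previous chain point** (σE-copy of stub-4's `StepProjection.exists_parent`): a
component of `X_{n+1}(ν)` through `x_{n+1}` whose label is `≤` the year of `X_n` dominates a component of `X_n(ν)` through `x_n` with the same
label, and maps into it. [cite: CossartJannsenSaito2020, Rem. 6.29 (1)] -/
theorem exists_parent (hf : StepProjectionσE σ N ν s s' f) {Z' : Set s'.W} (hZ' : Z' ∈ componentsThrough N ν s'.toMarkedStage) {j : ℕ}
    (hl : s'.L.label Z' = j) (hj : j ≤ s.L.year) :
    closure (f.base '' Z') ∈ componentsThrough N ν s.toMarkedStage ∧ s.L.label (closure (f.base '' Z')) = j ∧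
      f.base '' Z' ⊆ closure (f.base '' Z') := by
  have hne : s'.L.label Z' ≠ s.L.year + 1 := by omega
  have hmem := hf.mem_componentsIn_of_label_ne hne
  exact ⟨hf.closure_image_mem_componentsThrough hZ' hmem, (hf.label_eq_of_mem hmem) ▸ hl, subset_closure⟩

end StepProjectionσE

/-! ## §2. Kernel (K-str) along σE-steps of a functional strategy on RunGood stages -/

section KStr

variable {k : Type u} [Field k] {f : s'.W ⟶ s.W} {C : s.W.IdealSheafData} {P' : Option (Pending (blowup C))}

/-- A RunGood stage is Noetherian. [folklore] -/
theorem RunGood.isNoetherian {W : Scheme.{u}} (h : RunGood k N ν W) : IsNoetherian W := by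
  obtain ⟨g, hg, hq⟩ := h.overField
  exact Scheme.isNoetherian_of_finiteType_over_field g

/-- **A DOMINATING COMPONENT OFF THE CENTRE IS THE STRICT TRANSFORM**, read on a σE-step projection `f : X_{n+1} ⟶ X_n` of a FUNCTIONAL strategy
(the centre `C` being that of THE step `σ` allows at the state of `X_n`), RunGood stages: `Z' = closure f⁻¹(Z ∖ V(C))`. σE-copy of stub-4's
`StepProjection.eq_strictTransformSet_of_closure_image_eq` over the strategy-free core `Moving.eq_strictTransformSet_blowup`.
[cite: GortzWedhorn2020, Prop. 13.91 (3), (13.19) p. 414] -/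
theorem StepProjectionσE.eq_strictTransformSet_of_closure_image_eq (hσ : σ.IsFunctional N ν) (hf : StepProjectionσE σ N ν s s' f)
    (hgood : RunGood k N ν s.W) (hgood' : RunGood k N ν s'.W) (hcs : σ.step s.W s.ln N ν s.L s.P s.E C P') {Z : Set s.W}
    (hZ : Z ∈ componentsIn (Scheme.hsStratum s.W N ν)) (hZC : ¬ Z ⊆ (C.support : Set s.W)) {Z' : Set s'.W}
    (hZ' : Z' ∈ componentsIn (Scheme.hsStratum s'.W N ν)) (hdom : closure (f.base '' Z') = Z) :
    Z' = strictTransformSet f (C.support : Set s.W) Z := by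
  obtain ⟨C₂, P₂, hln, x', hcs₂, hπ, hcl, hx', e, rfl⟩ := hf
  obtain rfl : C₂ = C := (hσ s.W s.ln s.L s.P s.E).1 C₂ C P₂ P' hcs₂ hcs
  subst e
  simp only [eqToHom_refl, Category.id_comp] at hdom ⊢
  haveI : IsLocallyNoetherian s.W := s.ln
  haveI : IsLocallyNoetherian (blowup C₂) := hln
  haveI : IsNoetherian s.W := hgood.isNoetherian
  haveI : IsNoetherian (blowup C₂) := hgood'.isNoetherian
  exact eq_strictTransformSet_blowup C₂ hgood'.isClosed_hsStratum hZ hZC hZ' hdom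

/-- **UNIQUENESS OF THE DOMINANT OFF THE CENTRE** along a σE-step of a functional strategy, RunGood stages.
[cite: GortzWedhorn2020, Prop. 13.91 (3)] -/
theorem StepProjectionσE.dominant_unique (hσ : σ.IsFunctional N ν) (hf : StepProjectionσE σ N ν s s' f) (hgood : RunGood k N ν s.W)
    (hgood' : RunGood k N ν s'.W) (hcs : σ.step s.W s.ln N ν s.L s.P s.E C P') {Z : Set s.W}
    (hZ : Z ∈ componentsIn (Scheme.hsStratum s.W N ν)) (hZC : ¬ Z ⊆ (C.support : Set s.W)) {Z' Z'' : Set s'.W}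
    (hZ' : Z' ∈ componentsIn (Scheme.hsStratum s'.W N ν)) (hZ'' : Z'' ∈ componentsIn (Scheme.hsStratum s'.W N ν))
    (hdom' : closure (f.base '' Z') = Z) (hdom'' : closure (f.base '' Z'') = Z) : Z' = Z'' := by
  rw [hf.eq_strictTransformSet_of_closure_image_eq hσ hgood hgood' hcs hZ hZC hZ' hdom',
    hf.eq_strictTransformSet_of_closure_image_eq hσ hgood hgood' hcs hZ hZC hZ'' hdom'']

/-- **(K-str) along one σE-step projection**, any functional `σ`, RunGood stages: a component `Z ∋ x_n` of `X_n(ν)` off the centre which is a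
regular curve at `x_n` has its dominating component of `X_{n+1}(ν)` through `x_{n+1}` (if any) a regular curve at `x_{n+1}`. σE-copy of stub-4's
`StepProjection.isRegularCurveAt_of_dominant` over the strategy-free core `Moving.isRegular_and_dim_le_one_strictTransform_blowup` (GW 13.91 /
13.96: the strict transform of `Z` is the blow-up of `Z_red` in the invertible ideal `C·𝒪_Z` near `x_n`).
[cite: GortzWedhorn2020, Prop. 13.91, Prop. 13.96 (2)] -/
theorem StepProjectionσE.isRegularCurveAt_of_dominant (hσ : σ.IsFunctional N ν) (hf : StepProjectionσE σ N ν s s' f)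
    (hgood : RunGood k N ν s.W) (hgood' : RunGood k N ν s'.W) (hcs : σ.step s.W s.ln N ν s.L s.P s.E C P') {Z : Set s.W}
    (hZ : Z ∈ componentsThrough N ν s.toMarkedStage) (hZC : ¬ Z ⊆ (C.support : Set s.W)) (hreg : IsRegularCurveAt s.toMarkedStage Z)
    {Z' : Set s'.W} (hZ' : Z' ∈ componentsThrough N ν s'.toMarkedStage) (hdom : closure (f.base '' Z') = Z) :
    IsRegularCurveAt s'.toMarkedStage Z' := by
  have hST := hf.eq_strictTransformSet_of_closure_image_eq hσ hgood hgood' hcs hZ.1 hZC hZ'.1 hdom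
  have hpt' : IsClosed ({s'.pt} : Set s'.W) := hf.isClosed_pt
  obtain ⟨hxZ, hregZ, hcurveZ⟩ := hreg
  haveI : IsLocallyNoetherian s.W := s.ln
  haveI : IsNoetherian s.W := hgood.isNoetherian
  have hZirr : IsIrreducible Z := componentsIn.isIrreducible hZ.1
  have hZcl : IsClosed Z := componentsIn.isClosed hgood.isClosed_hsStratum hZ.1
  have hZ'irr : IsIrreducible Z' := componentsIn.isIrreducible hZ'.1
  have hZ'cl : IsClosed Z' := componentsIn.isClosed hgood'.isClosed_hsStratum hZ'.1
  have hdimZ := ringKrullDim_quotient_le_one_of_curve hZcl hcurveZ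
  obtain ⟨C₂, P₂, hln, x', hcs₂, hπ, hcl, hx', e, rfl⟩ := hf
  obtain rfl : C₂ = C := (hσ s.W s.ln s.L s.P s.E).1 C₂ C P₂ P' hcs₂ hcs
  subst e
  simp only [eqToHom_refl, Category.id_comp] at hST hdom ⊢
  haveI : IsLocallyNoetherian (blowup C₂) := hln
  haveI : IsNoetherian (blowup C₂) := hgood'.isNoetherian
  -- the core theorem at `x'`
  have hx'T : x' ∈ strictTransformSet (blowup.π C₂) (C₂.support : Set s.W) Z := hST ▸ hZ'.2
  obtain ⟨hreg', hdim'⟩ := isRegular_and_dim_le_one_strictTransform_blowup C₂ hZirr hZcl hZC hxZ (hregZ hZcl) hdimZ hx'T hπ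
  have hcleq : ∀ hcl' : IsClosed Z', (Scheme.IdealSheafData.vanishingIdeal (⟨Z', hcl'⟩ : Closeds ↥(blowup C₂))) =
      Scheme.IdealSheafData.vanishingIdeal ⟨strictTransformSet (blowup.π C₂) (C₂.support : Set s.W) Z,
        strictTransformSet.isClosed _ _ _⟩ := fun hcl' => by congr 1; exact Closeds.ext hST
  refine ⟨hZ'.2, fun hcl' => by rw [hcleq hcl']; exact hreg', ?_⟩
  exact curve_of_ringKrullDim_quotient_le_one hZ'irr hZ'cl hcl (by rw [hcleq hZ'cl]; exact hdim')

end KStr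

/-! ## §3. One step of the label-clean calculus along a σE-step: persist, birth, reset -/

section OneStep

variable {k : Type u} [Field k] {f : s'.W ⟶ s.W} {C : s.W.IdealSheafData} {P' : Option (Pending (blowup C))}

/-- **(persist) A clean old label stays clean along a σE-step of a functional strategy on RunGood stages**, given (K-ctr) AT THIS STEP (the members
through `x_{n+1}` mapping into the centre are at most one and regular curves); (K-str) is discharged by §2. σE-copy of stub-4's
`LabelCleanAt.persist`. [cite: CossartJannsenSaito2020, Rem. 6.29 (1)] -/
theorem LabelCleanAt.persist_σE (hσ : σ.IsFunctional N ν) (hf : StepProjectionσE σ N ν s s' f) (hgood : RunGood k N ν s.W)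
    (hgood' : RunGood k N ν s'.W) (hcs : σ.step s.W s.ln N ν s.L s.P s.E C P')
    (hctr : s.pt ∈ (C.support : Set s.W) →
      (∀ Z' ∈ componentsThrough N ν s'.toMarkedStage, ∀ Z'' ∈ componentsThrough N ν s'.toMarkedStage,
          f.base '' Z' ⊆ (C.support : Set s.W) → f.base '' Z'' ⊆ (C.support : Set s.W) → Z' = Z'') ∧
      ∀ Z' ∈ componentsThrough N ν s'.toMarkedStage, f.base '' Z' ⊆ (C.support : Set s.W) → IsRegularCurveAt s'.toMarkedStage Z')
    {j : ℕ} (hj : j ≤ s.L.year) (hclean : LabelCleanAt N ν s.toMarkedStage j) : LabelCleanAt N ν s'.toMarkedStage j := by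
  -- the parent of any label-`j` member through `x_{n+1}` is THE clean member through `x_n`
  have hpar : ∀ Z' ∈ componentsThrough N ν s'.toMarkedStage, s'.L.label Z' = j →
      closure (f.base '' Z') ∈ componentsThrough N ν s.toMarkedStage ∧ s.L.label (closure (f.base '' Z')) = j ∧
        f.base '' Z' ⊆ closure (f.base '' Z') := fun Z' hZ' hl => hf.exists_parent hZ' hl hj
  refine ⟨fun Z' hZ' Z'' hZ'' hl' hl'' => ?_, fun Z' hZ' hl' => ?_⟩
  · obtain ⟨hP', hlP', hsub'⟩ := hpar Z' hZ' hl'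
    obtain ⟨hP'', hlP'', hsub''⟩ := hpar Z'' hZ'' hl''
    have heq : closure (f.base '' Z'') = closure (f.base '' Z') := hclean.1 _ hP'' _ hP' hlP'' hlP'
    by_cases hZC : closure (f.base '' Z') ⊆ (C.support : Set s.W)
    · have hxC : s.pt ∈ (C.support : Set s.W) := hZC hP'.2
      exact (hctr hxC).1 Z' hZ' Z'' hZ'' (hsub'.trans hZC) (hsub''.trans (heq ▸ hZC))
    · exact hf.dominant_unique hσ hgood hgood' hcs hP'.1 hZC hZ'.1 hZ''.1 rfl heq
  · obtain ⟨hP', hlP', hsub'⟩ := hpar Z' hZ' hl'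
    by_cases hZC : closure (f.base '' Z') ⊆ (C.support : Set s.W)
    · have hxC : s.pt ∈ (C.support : Set s.W) := hZC hP'.2
      exact (hctr hxC).2 Z' hZ' (hsub'.trans hZC)
    · exact hf.isRegularCurveAt_of_dominant hσ hgood hgood' hcs hP' hZC (hclean.2 _ hP' hlP') hZ' rfl

/-- **Newborn components lie over the centre**, along a σE-step projection with PERMISSIBLE centre on RunGood stages: a component of `X_{n+1}(ν)`
which dominates no component of `X_n(ν)` maps into `V(C)` (CJS Thm. 3.10 (1): `H^N` does not increase, so the blow-down maps the stratum into the
stratum; off the centre the blow-down is an isomorphism). [cite: CossartJannsenSaito2020, Thm. 3.10 (1), Rem. 6.29 (1)] -/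
theorem StepProjectionσE.image_subset_support_of_not_mem (hσ : σ.IsFunctional N ν) (hf : StepProjectionσE σ N ν s s' f)
    (hgood : RunGood k N ν s.W) (hgood' : RunGood k N ν s'.W) (hcs : σ.step s.W s.ln N ν s.L s.P s.E C P')
    (hperm : IdealSheafData.IsPermissible C) {Z' : Set s'.W} (hZ' : Z' ∈ componentsIn (Scheme.hsStratum s'.W N ν))
    (hnot : closure (f.base '' Z') ∉ componentsIn (Scheme.hsStratum s.W N ν)) : f.base '' Z' ⊆ (C.support : Set s.W) := by
  obtain ⟨C₂, P₂, hln, x', hcs₂, hπ, hcl, hx', e, rfl⟩ := hf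
  obtain rfl : C₂ = C := (hσ s.W s.ln s.L s.P s.E).1 C₂ C P₂ P' hcs₂ hcs
  subst e
  simp only [eqToHom_refl, Category.id_comp] at hnot ⊢
  haveI : IsLocallyNoetherian s.W := s.ln
  haveI : IsLocallyNoetherian (blowup C₂) := hln
  haveI : IsNoetherian s.W := hgood.isNoetherian
  haveI : IsNoetherian (blowup C₂) := hgood'.isNoetherian
  have hexc : Scheme.IsExcellent s.W := hgood.isExcellent
  have hY : IsClosed (Scheme.hsStratum s.W N ν) := hgood.isClosed_hsStratum
  have hY' : IsClosed (Scheme.hsStratum (blowup C₂) N ν) := hgood'.isClosed_hsStratum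
  have hπY' : (blowup.π C₂).base '' Scheme.hsStratum (blowup C₂) N ν ⊆ Scheme.hsStratum s.W N ν := by
    rintro _ ⟨z, hz, rfl⟩
    have hle := (blowup.isBlowup C₂).hsFun_le_of_isPermissible hexc hperm N z
    exact hgood.supMax _ ((Scheme.mem_hsStratum_iff.mp hz).symm.le.trans hle)
  have hST : ∀ T, T ⊆ Scheme.hsStratum s.W N ν →
      strictTransformSet (blowup.π C₂) (C₂.support : Set s.W) T ⊆ Scheme.hsStratum (blowup C₂) N ν :=
    fun T hT => strictTransformSet_subset_hsStratum C₂ hT hY'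
  have hsub : Z' ⊆ (blowup.π C₂).base ⁻¹' (C₂.support : Set s.W) :=
    subset_preimage_support_of_not_mem_componentsIn C₂ hY (componentsIn.finite _) hY' (componentsIn.finite _) hπY' hST hZ' hnot
  rintro _ ⟨z, hz, rfl⟩
  exact hsub hz

/-- **(birth) The new label is clean along a σE-step of a functional strategy with permissible centre on RunGood stages**, given (K-ctr) AT THIS
STEP: a newborn component through `x_{n+1}` lies over the centre, which then contains `x_n`. σE-copy of stub-4's `labelCleanAt_birth`.
[cite: CossartJannsenSaito2020, Rem. 6.29 (1)] -/
theorem labelCleanAt_birth_σE (hσ : σ.IsFunctional N ν) (hf : StepProjectionσE σ N ν s s' f) (hgood : RunGood k N ν s.W)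
    (hgood' : RunGood k N ν s'.W) (hcs : σ.step s.W s.ln N ν s.L s.P s.E C P') (hperm : IdealSheafData.IsPermissible C)
    (hlab : ∀ Z, s.L.label Z ≤ s.L.year)
    (hctr : s.pt ∈ (C.support : Set s.W) →
      (∀ Z' ∈ componentsThrough N ν s'.toMarkedStage, ∀ Z'' ∈ componentsThrough N ν s'.toMarkedStage,
          f.base '' Z' ⊆ (C.support : Set s.W) → f.base '' Z'' ⊆ (C.support : Set s.W) → Z' = Z'') ∧
      ∀ Z' ∈ componentsThrough N ν s'.toMarkedStage, f.base '' Z' ⊆ (C.support : Set s.W) → IsRegularCurveAt s'.toMarkedStage Z') :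
    LabelCleanAt N ν s'.toMarkedStage (s.L.year + 1) := by
  -- a component with the new label is newborn, hence lies over the centre
  have hover : ∀ Z' ∈ componentsThrough N ν s'.toMarkedStage, s'.L.label Z' = s.L.year + 1 →
      f.base '' Z' ⊆ (C.support : Set s.W) := by
    intro Z' hZ' hl
    have hnot : closure (f.base '' Z') ∉ componentsIn (Scheme.hsStratum s.W N ν) := by
      intro hmem
      have h1 := hf.label_eq_of_mem hmem
      have h2 := hlab (closure (f.base '' Z'))
      omega
    exact hf.image_subset_support_of_not_mem hσ hgood hgood' hcs hperm hZ'.1 hnot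
  have hxC : ∀ Z' ∈ componentsThrough N ν s'.toMarkedStage, s'.L.label Z' = s.L.year + 1 → s.pt ∈ (C.support : Set s.W) := by
    intro Z' hZ' hl
    have := hover Z' hZ' hl ⟨s'.pt, hZ'.2, rfl⟩
    rwa [hf.base_pt] at this
  refine ⟨fun Z' hZ' Z'' hZ'' hl' hl'' => ?_, fun Z' hZ' hl' => ?_⟩
  · exact (hctr (hxC Z' hZ' hl')).1 Z' hZ' Z'' hZ'' (hover Z' hZ' hl') (hover Z'' hZ'' hl'')
  · exact (hctr (hxC Z' hZ' hl')).2 Z' hZ' (hover Z' hZ' hl')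

/-- **(reset) After a step whose centre IS the part `Y_n^{(j)}` the label `j` is clean**, along a σE-step, given (K-ctr) AT THIS STEP: the
label-`j` members through `x_{n+1}` dominate label-`j` members through `x_n`, which lie in the centre. This is the END step of a fallback cycle of
the menu hybrid (`IsReplayStep … (nil) C P'`: `C = vanishingIdeal Y_n^{(j)}`). σE-form of stub-4's `labelCleanAt_reset`.
[cite: CossartJannsenSaito2020, Rem. 6.29 (1)] -/
theorem labelCleanAt_reset_of_support_eq (hf : StepProjectionσE σ N ν s s' f) {j : ℕ}
    (hsupp : (C.support : Set s.W) = s.L.part (Scheme.hsStratum s.W N ν) j) (hjy : j ≤ s.L.year)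
    (hctr : s.pt ∈ (C.support : Set s.W) →
      (∀ Z' ∈ componentsThrough N ν s'.toMarkedStage, ∀ Z'' ∈ componentsThrough N ν s'.toMarkedStage,
          f.base '' Z' ⊆ (C.support : Set s.W) → f.base '' Z'' ⊆ (C.support : Set s.W) → Z' = Z'') ∧
      ∀ Z' ∈ componentsThrough N ν s'.toMarkedStage, f.base '' Z' ⊆ (C.support : Set s.W) → IsRegularCurveAt s'.toMarkedStage Z') :
    LabelCleanAt N ν s'.toMarkedStage j := by
  -- label-`j` members through `x_{n+1}` map into the centre, which then contains `x_n`
  have hover : ∀ Z' ∈ componentsThrough N ν s'.toMarkedStage, s'.L.label Z' = j →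
      f.base '' Z' ⊆ (C.support : Set s.W) ∧ s.pt ∈ (C.support : Set s.W) := by
    intro Z' hZ' hl
    obtain ⟨hP, hlP, hsub⟩ := hf.exists_parent hZ' hl hjy
    have hPC : closure (f.base '' Z') ⊆ (C.support : Set s.W) := hsupp ▸ s.L.subset_part hP.1 hlP
    exact ⟨hsub.trans hPC, hPC hP.2⟩
  refine ⟨fun Z' hZ' Z'' hZ'' hl' hl'' => ?_, fun Z' hZ' hl' => ?_⟩
  · exact (hctr (hover Z' hZ' hl').2).1 Z' hZ' Z'' hZ'' (hover Z' hZ' hl').1 (hover Z'' hZ'' hl'').1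
  · exact (hctr (hover Z' hZ' hl').2).2 Z' hZ' (hover Z' hZ' hl').1

end OneStep

end Summit.ResolutionOfSingularities.ResolutionOfSingularities.Theorems.SigmaMaxModificationsCorridor3.Sigma

end
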